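import Mathlib

/-!
# The six-corner hull lemma — a linear functional on one fibre of gates
(blind cell PercRepro2, night-2 g31; proofs/NIGHT2-DARC.md §73.6)

On one FIBRE of the sure-entered clusters (the four clusters `W`, `W + j`, `W + j'`, `W + j + j'` with
`d`-masses `b, b₁, b₂, b₁₂`) an admissible gate is a 4-tuple of ratios `(v₀, vₓ, v_y, vₓy)` with
`0 ≤ v₀ ≤ vₓ, v_y ≤ vₓy ≤ 1` (the gate ratio `d'/d` is increasing) and `vₓ·v_y ≤ ρ·v₀·vₓy`,
`ρ = b·b₁₂/(b₁·b₂) ≥ 1` (the gate law is log-supermodular: `d'(W+j)·d'(W+j') ≤ d'(W)·d'(W+j+j')`).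
The (XA′) functional is AFFINE in the tuple; the convex hull of the admissible region is the polytope with
the six vertices `0` (closed), `(0,0,0,1)` (top), `(0,1,0,1)` (`mj`), `(0,0,1,1)` (`mj'`),
`(1/ρ,1,1,1)` (`m⁻`, the lsm-tight unmarked value) and `(1,1,1,1)` (`m`) — McCormick:
`vₓ·v_y ≥ vₓ + v_y − vₓy` on the cone.  So an affine functional that is nonnegative at the six
vertices is nonnegative on the whole region: `hull_six` (ratio form, no division) and `hull_six_mass`
(mass form: the gate masses `r₀, rₓ, r_y, ω` against `b, b₁, b₂, b₁₂`).  The proof is four explicit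
convex combinations (sign of the unmarked coefficient × which side of the McCormick line).
-/

namespace Summit.Ventures.PercRepro2.Coin

section HullSix

variable {R : Type*} [Field R] [LinearOrder R] [IsStrictOrderedRing R]

/-- **The six-corner hull lemma (ratio form).**  An affine functional `c₀ + C·v₀ + Bₓ·vₓ + B_y·v_y + Cₓy·vₓy`
that is nonnegative at the six corners is nonnegative on the admissible fibre region. -/
theorem hull_six (c0 C Bx By Cxy ρ v0 vx vy vxy : R) (hρ : 1 ≤ ρ)
    (h0 : 0 ≤ v0) (h0x : v0 ≤ vx) (h0y : v0 ≤ vy) (hx : vx ≤ vxy) (hy : vy ≤ vxy) (h1 : vxy ≤ 1)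
    (hlsm : vx * vy ≤ ρ * v0 * vxy)
    (Hc : 0 ≤ c0) (Ht : 0 ≤ c0 + Cxy) (Hmj : 0 ≤ c0 + Cxy + Bx) (Hmjp : 0 ≤ c0 + Cxy + By)
    (Hmm : 0 ≤ ρ * (c0 + Cxy + Bx + By) + C) (Hm : 0 ≤ c0 + Cxy + Bx + By + C) :
    0 ≤ c0 + C * v0 + Bx * vx + By * vy + Cxy * vxy := by
  have hvx0 : 0 ≤ vx := le_trans h0 h0x
  have hvy0 : 0 ≤ vy := le_trans h0 h0y
  have hvxy0 : 0 ≤ vxy := le_trans hvx0 hx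
  rcases hvxy0.lt_or_eq with hxyp | hxy0
  · by_cases hC : 0 ≤ C
    · by_cases hs : vxy ≤ vx + vy
      · have hρ0 : 0 < ρ := by linarith
        have key : vx + vy - vxy ≤ ρ * v0 := by
          have h1' : (vx + vy - vxy) * vxy ≤ ρ * v0 * vxy := by
            nlinarith [mul_nonneg (sub_nonneg.2 hx) (sub_nonneg.2 hy), hlsm]
          exact le_of_mul_le_mul_right h1' hxyp
        have e : ρ * (c0 + C * v0 + Bx * vx + By * vy + Cxy * vxy)
            = ρ * (1 - vxy) * c0 + (vxy - vy) * ρ * (c0 + Cxy + Bx) + (vxy - vx) * ρ * (c0 + Cxy + By)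
              + (vx + vy - vxy) * (ρ * (c0 + Cxy + Bx + By) + C) + C * (ρ * v0 - (vx + vy - vxy)) := by ring
        have hpos : 0 ≤ ρ * (c0 + C * v0 + Bx * vx + By * vy + Cxy * vxy) := by
          rw [e]
          have t1 : 0 ≤ ρ * (1 - vxy) * c0 := mul_nonneg (mul_nonneg hρ0.le (by linarith)) Hc
          have t2 : 0 ≤ (vxy - vy) * ρ * (c0 + Cxy + Bx) := mul_nonneg (mul_nonneg (by linarith) hρ0.le) Hmj
          have t3 : 0 ≤ (vxy - vx) * ρ * (c0 + Cxy + By) := mul_nonneg (mul_nonneg (by linarith) hρ0.le) Hmjp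
          have t4 : 0 ≤ (vx + vy - vxy) * (ρ * (c0 + Cxy + Bx + By) + C) := mul_nonneg (by linarith) Hmm
          have t5 : 0 ≤ C * (ρ * v0 - (vx + vy - vxy)) := mul_nonneg hC (by linarith)
          linarith
        exact (mul_nonneg_iff_of_pos_left hρ0).mp hpos
      · have hs' : vx + vy < vxy := not_le.mp hs
        have e : c0 + C * v0 + Bx * vx + By * vy + Cxy * vxy
            = (1 - vxy) * c0 + (vxy - vx - vy) * (c0 + Cxy) + vx * (c0 + Cxy + Bx) + vy * (c0 + Cxy + By) + C * v0 := by ring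
        rw [e]
        have t1 : 0 ≤ (1 - vxy) * c0 := mul_nonneg (by linarith) Hc
        have t2 : 0 ≤ (vxy - vx - vy) * (c0 + Cxy) := mul_nonneg (by linarith) Ht
        have t3 : 0 ≤ vx * (c0 + Cxy + Bx) := mul_nonneg hvx0 Hmj
        have t4 : 0 ≤ vy * (c0 + Cxy + By) := mul_nonneg hvy0 Hmjp
        have t5 : 0 ≤ C * v0 := mul_nonneg hC h0
        linarith
    · have hC' : C < 0 := not_le.mp hC
      by_cases hxy : vx ≤ vy
      · have e : c0 + C * v0 + Bx * vx + By * vy + Cxy * vxy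
            = (1 - vxy) * c0 + (vxy - vy) * (c0 + Cxy) + (vy - vx) * (c0 + Cxy + By)
              + vx * (c0 + Cxy + Bx + By + C) + C * (v0 - vx) := by ring
        rw [e]
        have t1 : 0 ≤ (1 - vxy) * c0 := mul_nonneg (by linarith) Hc
        have t2 : 0 ≤ (vxy - vy) * (c0 + Cxy) := mul_nonneg (by linarith) Ht
        have t3 : 0 ≤ (vy - vx) * (c0 + Cxy + By) := mul_nonneg (by linarith) Hmjp
        have t4 : 0 ≤ vx * (c0 + Cxy + Bx + By + C) := mul_nonneg hvx0 Hm
        have t5 : 0 ≤ C * (v0 - vx) := mul_nonneg_of_nonpos_of_nonpos hC'.le (by linarith)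
        linarith
      · have hxy' : vy < vx := not_le.mp hxy
        have e : c0 + C * v0 + Bx * vx + By * vy + Cxy * vxy
            = (1 - vxy) * c0 + (vxy - vx) * (c0 + Cxy) + (vx - vy) * (c0 + Cxy + Bx)
              + vy * (c0 + Cxy + Bx + By + C) + C * (v0 - vy) := by ring
        rw [e]
        have t1 : 0 ≤ (1 - vxy) * c0 := mul_nonneg (by linarith) Hc
        have t2 : 0 ≤ (vxy - vx) * (c0 + Cxy) := mul_nonneg (by linarith) Ht
        have t3 : 0 ≤ (vx - vy) * (c0 + Cxy + Bx) := mul_nonneg (by linarith) Hmj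
        have t4 : 0 ≤ vy * (c0 + Cxy + Bx + By + C) := mul_nonneg hvy0 Hm
        have t5 : 0 ≤ C * (v0 - vy) := mul_nonneg_of_nonpos_of_nonpos hC'.le (by linarith)
        linarith
  · have hvx : vx = 0 := le_antisymm (hxy0 ▸ hx) hvx0
    have hvy : vy = 0 := le_antisymm (hxy0 ▸ hy) hvy0
    have hv0 : v0 = 0 := le_antisymm (hvx ▸ h0x) h0
    rw [hvx, hvy, hv0, ← hxy0]
    linarith

/-- **The six-corner hull lemma (mass form).**  Gate masses `r₀, rₓ, r_y, ω` on the four clusters of a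
fibre with `d`-masses `b, b₁, b₂, b₁₂ > 0`: the gate ratio increasing (`r₀·b₁ ≤ rₓ·b`, …, `ω ≤ b₁₂`),
the gate log-supermodular (`rₓ·r_y ≤ r₀·ω`), `d` log-supermodular on the fibre (`b₁·b₂ ≤ b·b₁₂`);
an affine functional nonnegative at the six corners (closed, top, `mj`, `mj'`, `m⁻` — scaled by `b₁₂` —
and `m`) is nonnegative at the gate. -/
theorem hull_six_mass (c0 C Bx By Cxy b b1 b2 b12 r0 rx ry ω : R)
    (hb : 0 < b) (hb1 : 0 < b1) (hb2 : 0 < b2) (hb12 : 0 < b12) (hΛ : b1 * b2 ≤ b * b12)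
    (hr0 : 0 ≤ r0) (h0x : r0 * b1 ≤ rx * b) (h0y : r0 * b2 ≤ ry * b)
    (hx : rx * b12 ≤ ω * b1) (hy : ry * b12 ≤ ω * b2) (hω : ω ≤ b12) (hlsm : rx * ry ≤ r0 * ω)
    (Hc : 0 ≤ c0) (Ht : 0 ≤ c0 + Cxy * b12) (Hmj : 0 ≤ c0 + Cxy * b12 + Bx * b1)
    (Hmjp : 0 ≤ c0 + Cxy * b12 + By * b2)
    (Hmm : 0 ≤ b12 * (c0 + Cxy * b12 + Bx * b1 + By * b2) + C * (b1 * b2))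
    (Hm : 0 ≤ c0 + Cxy * b12 + Bx * b1 + By * b2 + C * b) :
    0 ≤ c0 + C * r0 + Bx * rx + By * ry + Cxy * ω := by
  have hb1b2 : 0 < b1 * b2 := mul_pos hb1 hb2
  have key := hull_six c0 (C * b) (Bx * b1) (By * b2) (Cxy * b12) (b * b12 / (b1 * b2)) (r0 / b) (rx / b1)
    (ry / b2) (ω / b12)
    (by rw [le_div_iff₀ hb1b2]; linarith)
    (div_nonneg hr0 hb.le)
    (by rw [div_le_div_iff₀ hb hb1]; linarith)
    (by rw [div_le_div_iff₀ hb hb2]; linarith)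
    (by rw [div_le_div_iff₀ hb1 hb12]; linarith)
    (by rw [div_le_div_iff₀ hb2 hb12]; linarith)
    (by rw [div_le_one hb12]; exact hω)
    (by
      have e : b * b12 / (b1 * b2) * (r0 / b) * (ω / b12) = r0 * ω / (b1 * b2) := by
        field_simp
      rw [e, div_mul_div_comm, div_le_div_iff₀ hb1b2 hb1b2]
      nlinarith [hlsm, hb1b2])
    Hc (by linarith) (by linarith) (by linarith)
    (by
      have e : b * b12 / (b1 * b2) * (c0 + Cxy * b12 + Bx * b1 + By * b2) + C * b
          = (b / (b1 * b2)) * (b12 * (c0 + Cxy * b12 + Bx * b1 + By * b2) + C * (b1 * b2)) := by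
        field_simp
      rw [e]; exact mul_nonneg (div_nonneg hb.le hb1b2.le) Hmm)
    (by linarith)
  have e : c0 + C * b * (r0 / b) + Bx * b1 * (rx / b1) + By * b2 * (ry / b2) + Cxy * b12 * (ω / b12)
      = c0 + C * r0 + Bx * rx + By * ry + Cxy * ω := by
    field_simp
  rw [e] at key
  exact key

end HullSix

end Summit.Ventures.PercRepro2.Coin
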